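import Summits.QuantumFields.YangMills.Theorems.BalabanUVNodesN15TwoSpacingGluingCubes
import Summits.QuantumFields.YangMills.Theorems.BalabanUVNodesN15BackgroundTupleCalculus
import HarnessLib

/-!
# THE GLUING STEP AT TWO LATTICE SPACINGS, IV: the COMMUTATOR PIECES `[Δ_a, M_{h_□}]∘G_□` of the remainder for a Laplacian-type `Δ_a = Σ_μ ∇_μ*∇_μ + W` — the
# lattice Leibniz identity `[∇*∇, M_h] = M_{∇*∇h} − M_{∇h}∘∇ − M_{∇⁻h}∘∇⁻` ((1.126)–(1.128)), the (2.134)-shaped letter `θ₀` FROM the cubes' entries 0∕1 and the partition's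
# smoothness (`θ₀ = O(M⁻¹)`: the `M ≥ M₁` guard a theorem), and its η-defect from the cubes' entry-0∕1 defects + the fits of `∇h`, `Δh` (dag-n15-c g11, FILE 46; N15 = NE2, s1)

Cell `pub-ymgap`, seat `pub-ymgap-dag-n15-c` (R134 (a); HUMAN RULING D-0062), generation 11.  `bears_on: R4∕N15 · K3⁷ SpineGivenEndpointR13SepCoPH (stmt-QuantumFields-20544)`.
Filed `--supports stmt-QuantumFields-20544 --as helper` — COUNT-NEUTRAL.  Two plumbing `def`s (`lapDir`, `lapOp`), the rest theorems; 0 `sorry`.  Imports BY NAME FILE 45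
`…N15TwoSpacingGluingCubes` (`commOp`, `hasMaj_diag_comp`, `hasMaj_fsum`; through it FILES 43∕44 and lit `T4EtaRateCoeffDefect.hasMaj_mulOp`∕`hasMaj_idef_mulOp`, `B6Prop26Gluing.mulOp`∕`ind`)
and g8 FILE 1 `…N15BackgroundTupleCalculus` (`fgrad`, `fgradAdj`, `bgrad`, `fgrad_apply` …: the lattice calculus of one-step shifts); nothing in the tree is modified.

WHY.  FILE 45 built [B6]'s parametrix pair from cubes and displayed the remainder's pieces `K_□ = [Δ_a, M_{h_□}]∘G_□` through (2.134)-shaped letters `θ₀·e^{−δd}`;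
[Balaban1984PropagatorsII] p. 239 obtains them *«Using the formulas (1.126)–(1.128)»* — the lattice Leibniz rules — from the cubes' propagators and their first covariant
derivatives ((2.133): *«|(G_□J)(x)|, |(∇G_□J)(x)| ≤ O(1)[(L^jη)², L^jη]e^{−δ₂…}»*) and the smoothness of the partition (*«|∂h_□| ≤ O(1)(ML^jη)^{−1}»*-type, p. 229), whence the
«O(M⁻¹)» of (2.134).  THIS FILE types that step for the Laplacian part of `Δ_a` EXACTLY and displays the non-local part `W` (`Q*aQ`, `DRD*`, curvature ∕ mass terms) through
its own commutator letter:
* §1 `lapDir n e := ∇*_e∇_e`, `lapOp n e W := Σ_μ lapDir n (e μ) + W`; ★★ `commOp_lapDir` — `[∇*∇, M_h] = M_{∇*∇h} − M_{∇h}∘∇ − M_{∇⁻h}∘∇⁻` (pointwise, all `n`); `commOp_add_left`,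
  `commOp_fsum_left`, ★ `commOp_lapOp_comp` (`[Δ_a, M_h]∘G = Σ_μ[M_{Δ_μh}G − M_{∇_μh}(∇_μG) − M_{∇⁻_μh}(∇⁻_μG)] + [W, M_h]G`);
* §2 ★★ `hasMaj_commOp_lapOp_comp` — THE (2.134) LETTER: from the cube's entries `G ≤ 1_S1_S·βe^{−δd}`, `∇_μ^±G ≤ 1_S1_S·β₁e^{−δd}`, the partition's `|∇^±_μh| ≤ c₁`, `|Δ_μh| ≤ c₂` and
  the `W`-letter `θ_W`: `[Δ_a, M_h]G ≤ 1_S(y)1_S(y′)·(|J|(c₂β + 2c₁β₁) + θ_W)·e^{−δd}` — with `c₁ = O(M⁻¹)`, `c₂ = O(M⁻²)` this is `θ₀ = O(M⁻¹)`;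
* §3 ★★ `hasMaj_idef_commOp_lapOp_comp` — ITS η-DEFECT from the cubes' entry-0∕1 two-grid defects (`m₀`, `m₁`), the fits of the partition's derivatives (`|∇′h′ − (∇h)∘π| ≤ o₁`,
  `|Δ′h′ − (Δh)∘π| ≤ o₂`) and the `W`-defect letter `r_W`: `≤ 1_S1_S·(|J|(o₂β + c₂m₀ + 2(o₁β₁ + c₁m₁)) + r_W)·e^{−δd}`;
* §4 ★★★ `hasMaj_idef_glued_of_cubeEntries` — FILE 45's ★★★ with the commutator letters DISCHARGED by §2–§3: the η-defect of the glued global propagator of `Δ_a = Σ∇*∇ + W` from the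
  cubes' ENTRIES 0∕1 at both spacings, their two-grid defects, the partition's smoothness and fits, the `W`-commutator letters, under `N_ov·θ₀·c_r < 1`.

HONEST FRAMING ∕ LIMITS.  Lattice calculus + block-majorant bookkeeping ([B6] (1.126)–(1.128) via [B4], (2.36), (2.91)–(2.92), (2.133)–(2.135) = MECHANISM; nothing of [B6]∕[B9] asserted).
DISPLAYED, located: the cubes' entry-0∕1 letters and two-grid defects at both spacings (the lineage's perturbative device on Dirichlet cubes in the cube's (3.35) gauge — no tree
producer), the `W`-part's commutator letters (for `Q*aQ`: block-local, `[Q*Q, M_h]` is `O(∇h)`; for `DRD*`: [B6] (2.93)'s `h²(1 − ζ)∂P∂*h′` terms — not typed), the partition's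
smoothness∕fits, per-cube locality.  NE2⁺ NOT PRINTED, NOT proved; N15 NOT discharged; counts of record UNMOVED (typed 28∕28 · discharged 5∕27); one finite 𝕋⁴ at fixed ε — NOT
infinite volume, NOT OS on ℝ⁴, NOT a mass gap, NOT Clay; R4 closes the conditional finite-𝕋⁴ rung `BalabanLadder.UV` only.  Restate-immune (no Theses import).
-/

noncomputable section

namespace Summit.QuantumFields.YangMills.BalabanUVNodes.N15.Gluing

open Literature.MathematicalPhysics.QuantumFieldTheory.Balaban1983to89
open Literature.MathematicalPhysics.QuantumFieldTheory.Balaban1983to89.B11SectG (BlockNorm HasMaj RowSum)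
open Literature.MathematicalPhysics.QuantumFieldTheory.Balaban1983to89.T4EtaRateDefect (idef idef_apply idef_comp idef_sub idef_add)
open Literature.MathematicalPhysics.QuantumFieldTheory.Balaban1983to89.T4EtaRateCoeffDefect (pull pull_apply diagK diagK_nonneg hasMaj_mulOp hasMaj_idef_mulOp)
open Literature.MathematicalPhysics.QuantumFieldTheory.Balaban1983to89.B6RandomWalk (Triangle254)
open Literature.MathematicalPhysics.QuantumFieldTheory.Balaban1983to89.B6Prop26Gluing (mulOp mulOp_apply ind ind_nonneg ind_le_one)
open Summit.QuantumFields.YangMills.BalabanUVNodes.N15.BackgroundLayer (fgrad fgradAdj bgrad fgrad_apply fgradAdj_apply bgrad_apply)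

/-! ## §1 The lattice Leibniz identity for `∇*∇` and the commutator of a Laplacian-type operator -/

section Leibniz

variable {X : Type} {J : Type} [Fintype J]

/-- THE DIRECTIONAL LATTICE LAPLACIAN `∇*_e∇_e` (`(∇*∇f)(x) = n²(2f(x) − f(ex) − f(e⁻¹x))`). [cite: Balaban1984PropagatorsI, (1.3) p.18 (lattice derivatives: shape)] -/
def lapDir (n : ℝ) (e : X ≃ X) : (X → ℝ) →ₗ[ℝ] (X → ℝ) := fgradAdj n e ∘ₗ fgrad n e

/-- A LAPLACIAN-TYPE OPERATOR `Δ_a = Σ_μ ∇_μ*∇_μ + W` (`W` = every further summand: averaging `Q*aQ`, gauge-fixing `DRD*`, curvature, mass). [cite: Balaban1985BackgroundPropagators, (3.26) p.395 (shape)] -/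
def lapOp (n : ℝ) (e : J → X ≃ X) (W : (X → ℝ) →ₗ[ℝ] (X → ℝ)) : (X → ℝ) →ₗ[ℝ] (X → ℝ) := (∑ μ, lapDir n (e μ)) + W

omit [Fintype J] in
/-- ★★ **THE LATTICE LEIBNIZ IDENTITY** ((1.126)–(1.128) type): `[∇*∇, M_h] = M_{∇*∇h} − M_{∇h}∘∇ − M_{∇⁻h}∘∇⁻` — EXACT, every spacing `n`. [cite: Balaban1984PropagatorsII, p.239 («Using the formulas (1.126)–(1.128)»: mechanism)] -/
theorem commOp_lapDir (n : ℝ) (e : X ≃ X) (h : X → ℝ) :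
    commOp (lapDir n e) h = mulOp (fgradAdj n e (fgrad n e h)) - mulOp (fgrad n e h) ∘ₗ fgrad n e - mulOp (bgrad n e h) ∘ₗ bgrad n e := by
  refine LinearMap.ext fun f => funext fun x => ?_
  simp only [commOp, lapDir, LinearMap.sub_apply, LinearMap.comp_apply, Pi.sub_apply, mulOp_apply, fgradAdj_apply, fgrad_apply, bgrad_apply, Equiv.apply_symm_apply]
  ring

omit [Fintype J] in
/-- The commutator is additive in the operator. [folklore] -/
theorem commOp_add_left (Δ₁ Δ₂ : (X → ℝ) →ₗ[ℝ] (X → ℝ)) (h : X → ℝ) : commOp (Δ₁ + Δ₂) h = commOp Δ₁ h + commOp Δ₂ h := by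
  simp only [commOp, LinearMap.add_comp, LinearMap.comp_add]
  abel

/-- … and over finite sums. [folklore] -/
theorem commOp_fsum_left (Δ : J → (X → ℝ) →ₗ[ℝ] (X → ℝ)) (h : X → ℝ) : commOp (∑ μ, Δ μ) h = ∑ μ, commOp (Δ μ) h := by
  refine LinearMap.ext fun f => ?_
  simp only [commOp, LinearMap.sub_apply, LinearMap.comp_apply, LinearMap.coe_sum, Finset.sum_apply, map_sum, Finset.sum_sub_distrib]

/-- ★ **THE COMMUTATOR PIECE OF THE REMAINDER, Laplacian-type `Δ_a`**: `[Δ_a, M_h]∘G = Σ_μ [M_{Δ_μh}∘G − M_{∇_μh}∘(∇_μ∘G) − M_{∇⁻_μh}∘(∇⁻_μ∘G)] + [W, M_h]∘G` — only the cube's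
entries 0 and 1 (both orientations) and the `W`-part appear. [cite: Balaban1984PropagatorsII, (2.91)–(2.92) p.239 (mechanism)] -/
theorem commOp_lapOp_comp (n : ℝ) (e : J → X ≃ X) (W G : (X → ℝ) →ₗ[ℝ] (X → ℝ)) (h : X → ℝ) :
    commOp (lapOp n e W) h ∘ₗ G =
      (∑ μ, (mulOp (fgradAdj n (e μ) (fgrad n (e μ) h)) ∘ₗ G - mulOp (fgrad n (e μ) h) ∘ₗ (fgrad n (e μ) ∘ₗ G) - mulOp (bgrad n (e μ) h) ∘ₗ (bgrad n (e μ) ∘ₗ G))) +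
        commOp W h ∘ₗ G := by
  rw [lapOp, commOp_add_left, commOp_fsum_left, LinearMap.add_comp]
  congr 1
  refine LinearMap.ext fun f => ?_
  simp only [LinearMap.comp_apply, LinearMap.coe_sum, Finset.sum_apply, commOp_lapDir, LinearMap.sub_apply]

end Leibniz

/-! ## §2 The (2.134) letter of the commutator piece from the cube's entries 0∕1 and the partition's smoothness -/

section Letter

variable {X : Type} [Fintype X] {J : Type} [Fintype J] {g : B6.Geometry} (blk : X → g.Site)

/-- One term `M_a∘T` with `|a| ≤ c` and `T ≤ 1_S1_S·βe^{−δd}` has `≤ 1_S1_S·cβe^{−δd}`. [folklore] -/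
theorem hasMaj_mulOp_comp_loc {a : X → ℝ} {T : (X → ℝ) →ₗ[ℝ] (X → ℝ)} {S : Set g.Site} {c β δ : ℝ} (hc : 0 ≤ c) (ha : ∀ x, |a x| ≤ c)
    (hT : HasMaj (BlockNorm.ofBlocks g blk) (BlockNorm.ofBlocks g blk) T (fun y y' => ind S y * ind S y' * (β * Real.exp (-(δ * g.dist y y'))))) :
    HasMaj (BlockNorm.ofBlocks g blk) (BlockNorm.ofBlocks g blk) (mulOp a ∘ₗ T) (fun y y' => ind S y * ind S y' * (c * β * Real.exp (-(δ * g.dist y y')))) := by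
  refine (hasMaj_diag_comp blk (fun _ => hc) (hasMaj_mulOp (g := g) blk (m := fun _ => c) (fun _ => hc) ha) hT).mono fun y y' => le_of_eq ?_
  ring

/-- ★★ **THE (2.134) LETTER FROM CUBE ENTRIES 0∕1**: with `G ≤ 1_S1_S·βe^{−δd}`, `∇_μG, ∇⁻_μG ≤ 1_S1_S·β₁e^{−δd}` (entries 0∕1 of the cube propagator, both orientations), the
partition's `|∇_μh|, |∇⁻_μh| ≤ c₁`, `|∇*_μ∇_μh| ≤ c₂` and the `W`-commutator letter `[W, M_h]G ≤ 1_S1_S·θ_We^{−δd}`: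
`[Δ_a, M_h]∘G ≤ 1_S(y)1_S(y′)·(|J|·(c₂β + 2c₁β₁) + θ_W)·e^{−δd}` — `θ₀ = O(M⁻¹)` when `c₁ = O(M⁻¹)`, `c₂ = O(M⁻²)`. [cite: Balaban1984PropagatorsII, (2.133)–(2.134) p.247 (shapes + mechanism)] -/
theorem hasMaj_commOp_lapOp_comp {n : ℝ} {e : J → X ≃ X} {W G : (X → ℝ) →ₗ[ℝ] (X → ℝ)} {h : X → ℝ} {S : Set g.Site} {β β₁ c₁ c₂ θW δ : ℝ}
    (hc₁ : 0 ≤ c₁) (hc₂ : 0 ≤ c₂)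
    (hh1 : ∀ μ x, |fgrad n (e μ) h x| ≤ c₁) (hh1b : ∀ μ x, |bgrad n (e μ) h x| ≤ c₁) (hh2 : ∀ μ x, |fgradAdj n (e μ) (fgrad n (e μ) h) x| ≤ c₂)
    (hG : HasMaj (BlockNorm.ofBlocks g blk) (BlockNorm.ofBlocks g blk) G (fun y y' => ind S y * ind S y' * (β * Real.exp (-(δ * g.dist y y')))))
    (hD : ∀ μ, HasMaj (BlockNorm.ofBlocks g blk) (BlockNorm.ofBlocks g blk) (fgrad n (e μ) ∘ₗ G) (fun y y' => ind S y * ind S y' * (β₁ * Real.exp (-(δ * g.dist y y')))))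
    (hDb : ∀ μ, HasMaj (BlockNorm.ofBlocks g blk) (BlockNorm.ofBlocks g blk) (bgrad n (e μ) ∘ₗ G) (fun y y' => ind S y * ind S y' * (β₁ * Real.exp (-(δ * g.dist y y')))))
    (hW : HasMaj (BlockNorm.ofBlocks g blk) (BlockNorm.ofBlocks g blk) (commOp W h ∘ₗ G) (fun y y' => ind S y * ind S y' * (θW * Real.exp (-(δ * g.dist y y'))))) :
    HasMaj (BlockNorm.ofBlocks g blk) (BlockNorm.ofBlocks g blk) (commOp (lapOp n e W) h ∘ₗ G)
      (fun y y' => ind S y * ind S y' * ((Fintype.card J * (c₂ * β + 2 * (c₁ * β₁)) + θW) * Real.exp (-(δ * g.dist y y')))) := by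
  have hterm : ∀ μ, HasMaj (BlockNorm.ofBlocks g blk) (BlockNorm.ofBlocks g blk)
      (mulOp (fgradAdj n (e μ) (fgrad n (e μ) h)) ∘ₗ G - mulOp (fgrad n (e μ) h) ∘ₗ (fgrad n (e μ) ∘ₗ G) - mulOp (bgrad n (e μ) h) ∘ₗ (bgrad n (e μ) ∘ₗ G))
      (fun y y' => ind S y * ind S y' * ((c₂ * β + 2 * (c₁ * β₁)) * Real.exp (-(δ * g.dist y y')))) := fun μ => by
    have t0 := hasMaj_mulOp_comp_loc blk hc₂ (hh2 μ) hG
    have t1 := hasMaj_mulOp_comp_loc blk hc₁ (hh1 μ) (hD μ)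
    have t2 := hasMaj_mulOp_comp_loc blk hc₁ (hh1b μ) (hDb μ)
    refine ((t0.sub t1).sub t2).mono fun y y' => le_of_eq ?_
    ring
  have hsum := hasMaj_fsum (b₁ := BlockNorm.ofBlocks g blk) (b₃ := BlockNorm.ofBlocks g blk) Finset.univ _ _ fun μ _ => hterm μ
  rw [commOp_lapOp_comp]
  refine (hsum.add hW).mono fun y y' => le_of_eq ?_
  simp only [Finset.sum_const, Finset.card_univ, nsmul_eq_mul]
  ring

end Letter

/-! ## §3 The η-defect of the commutator piece from the cube's entry-0∕1 defects and the fits of `∇h`, `Δh` -/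

section LetterDefect

variable {X X' : Type} [Fintype X] [Fintype X'] {J : Type} [Fintype J] {g : B6.Geometry} (blk : X → g.Site) (π : X' → X)

/-- One term: `𝔇(M_{a′}T′, M_aT) = M_{a′}∘𝔇(T′,T) + 𝔇(M_{a′},M_a)∘T ≤ 1_S1_S·(c·m + o·β)e^{−δd}` from `|a′| ≤ c`, the fit `|a′ − a∘π| ≤ o`, `T ≤ 1_S1_S·βe^{−δd}` and
`𝔇(T′,T) ≤ 1_S1_S·me^{−δd}`. [folklore] -/
theorem hasMaj_idef_mulOp_comp_loc {a : X → ℝ} {a' : X' → ℝ} {T : (X → ℝ) →ₗ[ℝ] (X → ℝ)} {T' : (X' → ℝ) →ₗ[ℝ] (X' → ℝ)} {S : Set g.Site} {c o β m δ : ℝ}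
    (hc : 0 ≤ c) (ho : 0 ≤ o) (ha' : ∀ x', |a' x'| ≤ c) (hfit : ∀ x', |a' x' - a (π x')| ≤ o)
    (hT : HasMaj (BlockNorm.ofBlocks g blk) (BlockNorm.ofBlocks g blk) T (fun y y' => ind S y * ind S y' * (β * Real.exp (-(δ * g.dist y y')))))
    (hDT : HasMaj (BlockNorm.ofBlocks g blk) (BlockNorm.ofBlocks g (blk ∘ π)) (idef (pull π) (pull π) T' T)
      (fun y y' => ind S y * ind S y' * (m * Real.exp (-(δ * g.dist y y'))))) :
    HasMaj (BlockNorm.ofBlocks g blk) (BlockNorm.ofBlocks g (blk ∘ π)) (idef (pull π) (pull π) (mulOp a' ∘ₗ T') (mulOp a ∘ₗ T))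
      (fun y y' => ind S y * ind S y' * ((c * m + o * β) * Real.exp (-(δ * g.dist y y')))) := by
  have hMa' := hasMaj_mulOp (g := g) (blk ∘ π) (m := fun _ => c) (fun _ => hc) ha'
  have hDM := hasMaj_idef_mulOp (g := g) blk π (o := fun _ => o) (fun _ => ho) hfit
  have t1 := hasMaj_diag_comp (blk ∘ π) (fun _ => hc) hMa' hDT
  have t2 := hasMaj_diag_comp blk (fun _ => ho) hDM hT
  rw [idef_comp (pull π) (pull π) (pull π)]
  refine (t1.add t2).mono fun y y' => le_of_eq ?_
  ring

/-- ★★ **THE η-DEFECT OF THE (2.134) PIECE FROM CUBE ENTRY-0∕1 DEFECTS**: fine letters `|∇′h′|, |∇′⁻h′| ≤ c₁`, `|∇′*∇′h′| ≤ c₂`, fits `|∇′_μh′ − (∇_μh)∘π|, |∇′⁻_μh′ − (∇⁻_μh)∘π| ≤ o₁`,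
`|∇′*∇′h′ − (∇*∇h)∘π| ≤ o₂`, coarse cube entries `G, ∇^±G ≤ 1_S1_S·(β, β₁)e^{−δd}`, their two-grid defects `𝔇(G′,G) ≤ 1_S1_S·m₀e^{−δd}`, `𝔇(∇′^±G′, ∇^±G) ≤ 1_S1_S·m₁e^{−δd}`, and the
`W`-part's defect letter `r_W`: `𝔇([Δ′_a, M_{h′}]G′, [Δ_a, M_h]G) ≤ 1_S1_S·(|J|(c₂m₀ + o₂β + 2(c₁m₁ + o₁β₁)) + r_W)·e^{−δd}`.
[cite: Balaban1984PropagatorsII, (2.133)–(2.134) p.247 (shapes); Balaban1985BackgroundPropagators, Thm 3.14 pp.426–427 (difference template)] -/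
theorem hasMaj_idef_commOp_lapOp_comp {n n' : ℝ} {e : J → X ≃ X} {e' : J → X' ≃ X'} {W G : (X → ℝ) →ₗ[ℝ] (X → ℝ)} {W' G' : (X' → ℝ) →ₗ[ℝ] (X' → ℝ)} {h : X → ℝ}
    {h' : X' → ℝ} {S : Set g.Site} {β β₁ c₁ c₂ o₁ o₂ m₀ m₁ rW δ : ℝ} (hc₁ : 0 ≤ c₁) (hc₂ : 0 ≤ c₂) (ho₁ : 0 ≤ o₁) (ho₂ : 0 ≤ o₂)
    (hh1 : ∀ μ x', |fgrad n' (e' μ) h' x'| ≤ c₁) (hh1b : ∀ μ x', |bgrad n' (e' μ) h' x'| ≤ c₁) (hh2 : ∀ μ x', |fgradAdj n' (e' μ) (fgrad n' (e' μ) h') x'| ≤ c₂)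
    (hf1 : ∀ μ x', |fgrad n' (e' μ) h' x' - fgrad n (e μ) h (π x')| ≤ o₁) (hf1b : ∀ μ x', |bgrad n' (e' μ) h' x' - bgrad n (e μ) h (π x')| ≤ o₁)
    (hf2 : ∀ μ x', |fgradAdj n' (e' μ) (fgrad n' (e' μ) h') x' - fgradAdj n (e μ) (fgrad n (e μ) h) (π x')| ≤ o₂)
    (hG : HasMaj (BlockNorm.ofBlocks g blk) (BlockNorm.ofBlocks g blk) G (fun y y' => ind S y * ind S y' * (β * Real.exp (-(δ * g.dist y y')))))
    (hD : ∀ μ, HasMaj (BlockNorm.ofBlocks g blk) (BlockNorm.ofBlocks g blk) (fgrad n (e μ) ∘ₗ G) (fun y y' => ind S y * ind S y' * (β₁ * Real.exp (-(δ * g.dist y y')))))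
    (hDb : ∀ μ, HasMaj (BlockNorm.ofBlocks g blk) (BlockNorm.ofBlocks g blk) (bgrad n (e μ) ∘ₗ G) (fun y y' => ind S y * ind S y' * (β₁ * Real.exp (-(δ * g.dist y y')))))
    (hDG : HasMaj (BlockNorm.ofBlocks g blk) (BlockNorm.ofBlocks g (blk ∘ π)) (idef (pull π) (pull π) G' G) (fun y y' => ind S y * ind S y' * (m₀ * Real.exp (-(δ * g.dist y y')))))
    (hDD : ∀ μ, HasMaj (BlockNorm.ofBlocks g blk) (BlockNorm.ofBlocks g (blk ∘ π)) (idef (pull π) (pull π) (fgrad n' (e' μ) ∘ₗ G') (fgrad n (e μ) ∘ₗ G))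
      (fun y y' => ind S y * ind S y' * (m₁ * Real.exp (-(δ * g.dist y y')))))
    (hDDb : ∀ μ, HasMaj (BlockNorm.ofBlocks g blk) (BlockNorm.ofBlocks g (blk ∘ π)) (idef (pull π) (pull π) (bgrad n' (e' μ) ∘ₗ G') (bgrad n (e μ) ∘ₗ G))
      (fun y y' => ind S y * ind S y' * (m₁ * Real.exp (-(δ * g.dist y y')))))
    (hDW : HasMaj (BlockNorm.ofBlocks g blk) (BlockNorm.ofBlocks g (blk ∘ π)) (idef (pull π) (pull π) (commOp W' h' ∘ₗ G') (commOp W h ∘ₗ G))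
      (fun y y' => ind S y * ind S y' * (rW * Real.exp (-(δ * g.dist y y'))))) :
    HasMaj (BlockNorm.ofBlocks g blk) (BlockNorm.ofBlocks g (blk ∘ π)) (idef (pull π) (pull π) (commOp (lapOp n' e' W') h' ∘ₗ G') (commOp (lapOp n e W) h ∘ₗ G))
      (fun y y' => ind S y * ind S y' * ((Fintype.card J * (c₂ * m₀ + o₂ * β + 2 * (c₁ * m₁ + o₁ * β₁)) + rW) * Real.exp (-(δ * g.dist y y')))) := by
  have hterm : ∀ μ, HasMaj (BlockNorm.ofBlocks g blk) (BlockNorm.ofBlocks g (blk ∘ π))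
      (idef (pull π) (pull π)
        (mulOp (fgradAdj n' (e' μ) (fgrad n' (e' μ) h')) ∘ₗ G' - mulOp (fgrad n' (e' μ) h') ∘ₗ (fgrad n' (e' μ) ∘ₗ G') - mulOp (bgrad n' (e' μ) h') ∘ₗ (bgrad n' (e' μ) ∘ₗ G'))
        (mulOp (fgradAdj n (e μ) (fgrad n (e μ) h)) ∘ₗ G - mulOp (fgrad n (e μ) h) ∘ₗ (fgrad n (e μ) ∘ₗ G) - mulOp (bgrad n (e μ) h) ∘ₗ (bgrad n (e μ) ∘ₗ G)))
      (fun y y' => ind S y * ind S y' * ((c₂ * m₀ + o₂ * β + 2 * (c₁ * m₁ + o₁ * β₁)) * Real.exp (-(δ * g.dist y y')))) := fun μ => by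
    have t0 := hasMaj_idef_mulOp_comp_loc blk π hc₂ ho₂ (hh2 μ) (hf2 μ) hG hDG
    have t1 := hasMaj_idef_mulOp_comp_loc blk π hc₁ ho₁ (hh1 μ) (hf1 μ) (hD μ) (hDD μ)
    have t2 := hasMaj_idef_mulOp_comp_loc blk π hc₁ ho₁ (hh1b μ) (hf1b μ) (hDb μ) (hDDb μ)
    rw [idef_sub, idef_sub]
    refine ((t0.sub t1).sub t2).mono fun y y' => le_of_eq ?_
    ring
  have hsum := hasMaj_fsum (b₁ := BlockNorm.ofBlocks g blk) (b₃ := BlockNorm.ofBlocks g (blk ∘ π)) Finset.univ _ _ fun μ _ => hterm μ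
  rw [commOp_lapOp_comp, commOp_lapOp_comp, idef_add, idef_fsum]
  refine (hsum.add hDW).mono fun y y' => le_of_eq ?_
  simp only [Finset.sum_const, Finset.card_univ, nsmul_eq_mul]
  ring

end LetterDefect

/-! ## §4 The glued global propagator of a Laplacian-type `Δ_a`: every letter = cube entries 0∕1 + partition smoothness + the `W`-part -/

section Glued

variable {X X' : Type} [Fintype X] [Fintype X'] [DecidableEq X] [DecidableEq X'] {J ι : Type} [Fintype J] [Fintype ι] {g : B6.Geometry} (blk : X → g.Site) (π : X' → X)
  (S : ι → Set g.Site) {σ cr : ℝ}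

/-- ★★★ **THE η-DEFECT OF THE GLUED GLOBAL PROPAGATOR OF `Δ_a = Σ_μ∇_μ*∇_μ + W` FROM CUBE ENTRIES.**  Data at two spacings: translations `e, e′`, spacings⁻¹ `n, n′`, local parts `W, W′`,
cube propagators `G_□, G_□′` with entries 0∕1 (both orientations) localized to reaches `S_□` of overlap `≤ N_ov` (`β, β₁`) and their two-grid defects (`m₀, m₁`), a quadratic partition
`h, h′` (`|h| ≤ 1`, fits `o`, derivative letters `c₁, c₂` and derivative fits `o₁, o₂`), the `W`-commutator letters (`θ_W`, `r_W`).  With `θ₀ := |J|(c₂β + 2c₁β₁) + θ_W` and the ONE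
smallness `N_ov·θ₀·c_r < 1`: `𝔇(G′, G) ≤ C·e^{−(δ−2σ)d}` for the glued inverses of FILE 45 (`C` = FILE 45's constant at `r := |J|(c₂m₀ + o₂β + 2(c₁m₁ + o₁β₁)) + r_W`).  The remainder's
«O(M⁻¹)» is now the partition's smoothness `c₁, c₂` — no (2.134)-type letter displayed. [cite: Balaban1984PropagatorsII, (2.36) p.229, (2.91)–(2.92) p.239, (2.133)–(2.136) p.247 (mechanism); Balaban1985BackgroundPropagators, p.399 (architecture)] -/
theorem hasMaj_idef_glued_of_cubeEntries (htri : Triangle254 g) (hd : ∀ a b : g.Site, 0 ≤ g.dist a b) (hd0 : ∀ y : g.Site, g.dist y y = 0) (hrow : RowSum g σ cr)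
    (hσ : 0 ≤ σ) (hcr : 0 ≤ cr) {n n' : ℝ} {e : J → X ≃ X} {e' : J → X' ≃ X'} {W : (X → ℝ) →ₗ[ℝ] (X → ℝ)} {W' : (X' → ℝ) →ₗ[ℝ] (X' → ℝ)} {h : ι → X → ℝ}
    {h' : ι → X' → ℝ} {G : ι → (X → ℝ) →ₗ[ℝ] (X → ℝ)} {G' : ι → (X' → ℝ) →ₗ[ℝ] (X' → ℝ)} {β β₁ c₁ c₂ θW o o₁ o₂ m₀ m₁ rW δ Nov : ℝ} (hβ : 0 ≤ β) (hβ₁ : 0 ≤ β₁)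
    (hc₁ : 0 ≤ c₁) (hc₂ : 0 ≤ c₂) (hθW : 0 ≤ θW) (ho : 0 ≤ o) (ho₁ : 0 ≤ o₁) (ho₂ : 0 ≤ o₂) (hm₀ : 0 ≤ m₀) (hm₁ : 0 ≤ m₁) (hrW : 0 ≤ rW) (hNov : 0 ≤ Nov) (hσδ : 2 * σ ≤ δ)
    (hh : ∀ i x, |h i x| ≤ 1) (hh' : ∀ i x', |h' i x'| ≤ 1) (hfit : ∀ i x', |h' i x' - h i (π x')| ≤ o) (hN : ∀ a, ∑ i, ind (S i) a ≤ Nov)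
    (hh1 : ∀ i μ x, |fgrad n (e μ) (h i) x| ≤ c₁) (hh1b : ∀ i μ x, |bgrad n (e μ) (h i) x| ≤ c₁) (hh2 : ∀ i μ x, |fgradAdj n (e μ) (fgrad n (e μ) (h i)) x| ≤ c₂)
    (hh1' : ∀ i μ x', |fgrad n' (e' μ) (h' i) x'| ≤ c₁) (hh1b' : ∀ i μ x', |bgrad n' (e' μ) (h' i) x'| ≤ c₁)
    (hh2' : ∀ i μ x', |fgradAdj n' (e' μ) (fgrad n' (e' μ) (h' i)) x'| ≤ c₂)
    (hf1 : ∀ i μ x', |fgrad n' (e' μ) (h' i) x' - fgrad n (e μ) (h i) (π x')| ≤ o₁) (hf1b : ∀ i μ x', |bgrad n' (e' μ) (h' i) x' - bgrad n (e μ) (h i) (π x')| ≤ o₁)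
    (hf2 : ∀ i μ x', |fgradAdj n' (e' μ) (fgrad n' (e' μ) (h' i)) x' - fgradAdj n (e μ) (fgrad n (e μ) (h i)) (π x')| ≤ o₂)
    (hG : ∀ i, HasMaj (BlockNorm.ofBlocks g blk) (BlockNorm.ofBlocks g blk) (G i) (fun y y' => ind (S i) y * ind (S i) y' * (β * Real.exp (-(δ * g.dist y y')))))
    (hG' : ∀ i, HasMaj (BlockNorm.ofBlocks g (blk ∘ π)) (BlockNorm.ofBlocks g (blk ∘ π)) (G' i)
      (fun y y' => ind (S i) y * ind (S i) y' * (β * Real.exp (-(δ * g.dist y y')))))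
    (hD : ∀ i μ, HasMaj (BlockNorm.ofBlocks g blk) (BlockNorm.ofBlocks g blk) (fgrad n (e μ) ∘ₗ G i)
      (fun y y' => ind (S i) y * ind (S i) y' * (β₁ * Real.exp (-(δ * g.dist y y')))))
    (hDb : ∀ i μ, HasMaj (BlockNorm.ofBlocks g blk) (BlockNorm.ofBlocks g blk) (bgrad n (e μ) ∘ₗ G i)
      (fun y y' => ind (S i) y * ind (S i) y' * (β₁ * Real.exp (-(δ * g.dist y y')))))
    (hD' : ∀ i μ, HasMaj (BlockNorm.ofBlocks g (blk ∘ π)) (BlockNorm.ofBlocks g (blk ∘ π)) (fgrad n' (e' μ) ∘ₗ G' i)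
      (fun y y' => ind (S i) y * ind (S i) y' * (β₁ * Real.exp (-(δ * g.dist y y')))))
    (hDb' : ∀ i μ, HasMaj (BlockNorm.ofBlocks g (blk ∘ π)) (BlockNorm.ofBlocks g (blk ∘ π)) (bgrad n' (e' μ) ∘ₗ G' i)
      (fun y y' => ind (S i) y * ind (S i) y' * (β₁ * Real.exp (-(δ * g.dist y y')))))
    (hW : ∀ i, HasMaj (BlockNorm.ofBlocks g blk) (BlockNorm.ofBlocks g blk) (commOp W (h i) ∘ₗ G i)
      (fun y y' => ind (S i) y * ind (S i) y' * (θW * Real.exp (-(δ * g.dist y y')))))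
    (hW' : ∀ i, HasMaj (BlockNorm.ofBlocks g (blk ∘ π)) (BlockNorm.ofBlocks g (blk ∘ π)) (commOp W' (h' i) ∘ₗ G' i)
      (fun y y' => ind (S i) y * ind (S i) y' * (θW * Real.exp (-(δ * g.dist y y')))))
    (hDG : ∀ i, HasMaj (BlockNorm.ofBlocks g blk) (BlockNorm.ofBlocks g (blk ∘ π)) (idef (pull π) (pull π) (G' i) (G i))
      (fun y y' => ind (S i) y * ind (S i) y' * (m₀ * Real.exp (-(δ * g.dist y y')))))
    (hDD : ∀ i μ, HasMaj (BlockNorm.ofBlocks g blk) (BlockNorm.ofBlocks g (blk ∘ π)) (idef (pull π) (pull π) (fgrad n' (e' μ) ∘ₗ G' i) (fgrad n (e μ) ∘ₗ G i))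
      (fun y y' => ind (S i) y * ind (S i) y' * (m₁ * Real.exp (-(δ * g.dist y y')))))
    (hDDb : ∀ i μ, HasMaj (BlockNorm.ofBlocks g blk) (BlockNorm.ofBlocks g (blk ∘ π)) (idef (pull π) (pull π) (bgrad n' (e' μ) ∘ₗ G' i) (bgrad n (e μ) ∘ₗ G i))
      (fun y y' => ind (S i) y * ind (S i) y' * (m₁ * Real.exp (-(δ * g.dist y y')))))
    (hDW : ∀ i, HasMaj (BlockNorm.ofBlocks g blk) (BlockNorm.ofBlocks g (blk ∘ π)) (idef (pull π) (pull π) (commOp W' (h' i) ∘ₗ G' i) (commOp W (h i) ∘ₗ G i))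
      (fun y y' => ind (S i) y * ind (S i) y' * (rW * Real.exp (-(δ * g.dist y y')))))
    (hq : Nov * (Fintype.card J * (c₂ * β + 2 * (c₁ * β₁)) + θW) * cr < 1) :
    HasMaj (BlockNorm.ofBlocks g blk) (BlockNorm.ofBlocks g (blk ∘ π))
      (idef (pull π) (pull π) (glueInv (parametrix h' G') (remainder (lapOp n' e' W') h' G')) (glueInv (parametrix h G) (remainder (lapOp n e W) h G)))
      (fun y y' => (Nov * β * ((1 - Nov * (Fintype.card J * (c₂ * β + 2 * (c₁ * β₁)) + θW) * cr)⁻¹ *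
          ((1 - Nov * (Fintype.card J * (c₂ * β + 2 * (c₁ * β₁)) + θW) * cr)⁻¹ *
            (Nov * ((Fintype.card J * (c₂ * β + 2 * (c₁ * β₁)) + θW) * o + (Fintype.card J * (c₂ * m₀ + o₂ * β + 2 * (c₁ * m₁ + o₁ * β₁)) + rW))) * cr) * cr) * cr +
        Nov * (2 * β * o + m₀) * (1 - Nov * (Fintype.card J * (c₂ * β + 2 * (c₁ * β₁)) + θW) * cr)⁻¹ * cr) * Real.exp (-((δ - 2 * σ) * g.dist y y'))) :=
  hasMaj_idef_glued_of_cubes blk π S htri hd hd0 hrow hσ hcr hβ (by positivity) hm₀ (by positivity) ho hNov hσδ hh hh' hfit hN hG hG'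
    (fun i => hasMaj_commOp_lapOp_comp blk hc₁ hc₂ (hh1 i) (hh1b i) (hh2 i) (hG i) (hD i) (hDb i) (hW i))
    (fun i => hasMaj_commOp_lapOp_comp (blk ∘ π) hc₁ hc₂ (hh1' i) (hh1b' i) (hh2' i) (hG' i) (hD' i) (hDb' i) (hW' i))
    hDG (fun i => hasMaj_idef_commOp_lapOp_comp blk π hc₁ hc₂ ho₁ ho₂ (hh1' i) (hh1b' i) (hh2' i) (hf1 i) (hf1b i) (hf2 i) (hG i) (hD i) (hDb i) (hDG i) (hDD i) (hDDb i) (hDW i))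
    hq

end Glued

end Summit.QuantumFields.YangMills.BalabanUVNodes.N15.Gluing

end
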